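import Literature.AlgebraicGeometry.ComplexMultiplication.RationalCMStructureBaseChange
import Literature.AlgebraicGeometry.Milne1999.HodgeCMImpliesTateFiniteFields
import Literature.AlgebraicGeometry.Motives.AbelianVarietySimpleFactorsUnique
import Literature.NumberTheory.DiophantineGeometry.AVIsogenyTateFreeHomProofs
import HarnessLib

/-!
# An abelian variety carrying a number field `M ⊂ End⁰(A)` of degree `2 dim A` is of CM type after base change to `ℂ`
# (Shimura's «abelian variety of type `(𝔎)`» ⟹ Milne's `IsOfCMType`, rational-structure form over any field of definition)

Topic `NumberTheory/ComplexMultiplication`; namespace `Literature.NumberTheory.ComplexMultiplication`.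
Cell hodgecm-mathlib (D-0151), T5 / VI-1″ currency (director ruling s105, 2026-08-29: «potential = geometric CM type is
EXACTLY the hypothesis shape (N9) ★ `faltings_tate_bijective_of_isOfCMType (A A') (hA : IsOfCMType (A.baseChange ℂ)) (hA')`
consumes»).  THIS FILE supplies that hypothesis shape for an abelian variety `A` over ANY field `k` with `[Algebra k ℂ]`
from a RATIONAL CM structure over `k` — a ring homomorphism `i : M →+* End⁰(A)` from a number field `M` with
`[M : ℚ] = 2 dim A` ([Shimura1998] §5.2 «abelian variety of type `(𝔎)`»; e.g. [Liu2021] Def. 4.5 (2)'s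
`i_μ : M_μ → End_E(A_μ)_ℚ` on the CM abelian variety `A_μ` over the CM field `E`, tree ★ `RestOne.iOne` / `RestOne.hdimOne`).
THEOREMS ONLY (no def, no structure, no named fact, no instance, no `sorry`); books 0.
HC_CM is proved only modulo the printed citations until rung 0 closes.

## What is proved
* `isOfCMType_of_ringHom` — over `ℂ`: `i : M →+* End⁰(B)`, `M` a number field, `[M : ℚ] = 2 dim B` ⟹ `IsOfCMType B`
  (the witness subalgebra is the image of `M`: a field, hence reduced and commutative, of `ℚ`-dimension `[M : ℚ]`
  because a ring homomorphism out of a field into the non-trivial ring `End⁰(B)` — `dim B > 0` since `[M : ℚ] ≥ 1` —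
  is injective);
* **`isOfCMType_baseChange_of_ringHom`** — over any `k` with `[Algebra k ℂ]`: the same data on `A / k` give
  `IsOfCMType (A.baseChange ℂ)`, by composing `i` with ★ `endAlgebraBaseChange ℂ A : End⁰(A) →ₐ[ℚ] End⁰(A_ℂ)`
  ([MumfordAV1970] §19) and ★ `dim_baseChange`.

## References
* [Shimura1998] G. Shimura, *Abelian Varieties with Complex Multiplication and Modular Functions* (1998), §5.2
  (pp. 36–37): abelian varieties of type `(𝔎)`, `[𝔎 : ℚ] = 2 dim A`.
* [Milne1999] J. S. Milne, *Lefschetz motives and the Tate conjecture*, Compositio Math. 117 (1999), §2 p. 54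
  (abelian varieties of CM-type).
* [MumfordAV1970] D. Mumford, *Abelian Varieties* (1970), §19 (`End⁰(X) = End(X) ⊗ ℚ`; Thm. 3).
-/

set_option autoImplicit false

open CategoryTheory
open Literature.AlgebraicGeometry.Motives Literature.AlgebraicGeometry.Motives.AbelianVariety
open Literature.AlgebraicGeometry.Milne1999 (IsOfCMType)

namespace Literature.NumberTheory.ComplexMultiplication

/-! ### §1 Over `ℂ` -/

/-- `dim B > 0` as soon as a number field of degree `2 dim B` is given (`[M : ℚ] ≥ 1`). [cite: Shimura1998, §5.2 (pp. 36–37)] -/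
theorem dim_pos_of_finrank_eq_two_mul_dim {k : Type} [Field k] (B : AbelianVariety k) {M : Type*} [Field M]
    [NumberField M] (hdim : Module.finrank ℚ M = 2 * B.dim) : 0 < B.dim := by
  have hpos : 0 < Module.finrank ℚ M := Module.finrank_pos
  omega

/-- `End⁰(B)` is non-trivial for `dim B > 0`: `𝟙_B ≠ 0` (★ `id_ne_zero_of_dim_pos`) and `End(B) → End⁰(B)` is
injective in characteristic zero (★ `endAlgebra.of_injective_of_charZero`, [MumfordAV1970] §19 Thm. 3).
[cite: MumfordAV1970, §19 Thm. 3] -/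
theorem nontrivial_endAlgebra_of_dim_pos_of_charZero {k : Type} [Field k] [CharZero k] (B : AbelianVariety k)
    (hB : 0 < B.dim) : Nontrivial B.endAlgebra := by
  refine ⟨⟨0, 1, fun h01 => id_ne_zero_of_dim_pos hB ?_⟩⟩
  have inj := endAlgebra.of_injective_of_charZero (A := B)
  have h : endAlgebra.of B 1 = endAlgebra.of B 0 := by rw [map_one, map_zero, h01]
  exact inj h

/-- **A rational CM structure makes a complex abelian variety of CM type**: if a number field `M` with
`[M : ℚ] = 2 dim B` maps by a ring homomorphism into `End⁰(B)`, then `B` is `IsOfCMType` — the image of `M` is a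
commutative reduced `ℚ`-subalgebra of `ℚ`-dimension `[M : ℚ] = 2 dim B` ([Shimura1998] §5.2: type `(𝔎)`; [Milne1999] §2
p. 54). [cite: Shimura1998, §5.2 (pp. 36–37)] [cite: Milne1999, §2 p. 54] -/
theorem isOfCMType_of_ringHom (B : AbelianVariety ℂ) {M : Type*} [Field M] [NumberField M]
    (i : M →+* B.endAlgebra) (hdim : Module.finrank ℚ M = 2 * B.dim) : IsOfCMType B := by
  haveI := nontrivial_endAlgebra_of_dim_pos_of_charZero B (dim_pos_of_finrank_eq_two_mul_dim B hdim)
  have hinj : Function.Injective i.toRatAlgHom := i.injective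
  let e : M ≃ₐ[ℚ] i.toRatAlgHom.range := AlgEquiv.ofInjective i.toRatAlgHom hinj
  refine ⟨i.toRatAlgHom.range, ?_, ?_, ?_⟩
  · exact isReduced_of_injective e.symm e.symm.injective
  · rintro x ⟨a, rfl⟩ y ⟨b, rfl⟩
    exact ((map_mul _ a b).symm.trans ((congrArg _ (mul_comm a b)).trans (map_mul _ b a)))
  · rw [← e.toLinearEquiv.finrank_eq, hdim]

/-! ### §2 Over any field of definition `k → ℂ` -/

/-- **The hypothesis shape of ★ `faltings_tate_bijective_of_isOfCMType`, from a rational CM structure over the field of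
definition**: for `A` over `k` (`[Algebra k ℂ]`), a number field `M` with `[M : ℚ] = 2 dim A` and a ring homomorphism
`i : M →+* End⁰(A)`, the complexification `A_ℂ` is of CM type — compose `i` with ★ `endAlgebraBaseChange ℂ A`
([MumfordAV1970] §19) and use `dim A_ℂ = dim A` (★ `dim_baseChange`). [cite: Shimura1998, §5.2 (pp. 36–37)]
[cite: Milne1999, §2 p. 54] [cite: MumfordAV1970, §19] -/
theorem isOfCMType_baseChange_of_ringHom {k : Type} [Field k] [Algebra k ℂ] (A : AbelianVariety k) {M : Type*}
    [Field M] [NumberField M] (i : M →+* A.endAlgebra) (hdim : Module.finrank ℚ M = 2 * A.dim) :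
    IsOfCMType (A.baseChange ℂ) :=
  isOfCMType_of_ringHom (A.baseChange ℂ) ((endAlgebraBaseChange ℂ A).toRingHom.comp i)
    (hdim.trans (by rw [dim_baseChange]))

/-- The same for two abelian varieties at once, in the binder order of ★ `faltings_tate_bijective_of_isOfCMType`
(both complexifications of CM type). [cite: Shimura1998, §5.2 (pp. 36–37)] [cite: Milne1999, §2 p. 54] -/
theorem isOfCMType_baseChange_of_ringHom_pair {k : Type} [Field k] [Algebra k ℂ] (A A' : AbelianVariety k)
    {M M' : Type*} [Field M] [NumberField M] [Field M'] [NumberField M']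
    (i : M →+* A.endAlgebra) (hdim : Module.finrank ℚ M = 2 * A.dim)
    (i' : M' →+* A'.endAlgebra) (hdim' : Module.finrank ℚ M' = 2 * A'.dim) :
    IsOfCMType (A.baseChange ℂ) ∧ IsOfCMType (A'.baseChange ℂ) :=
  ⟨isOfCMType_baseChange_of_ringHom A i hdim, isOfCMType_baseChange_of_ringHom A' i' hdim'⟩

end Literature.NumberTheory.ComplexMultiplication
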